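import Summits.BirchSwinnertonDyer.BirchSwinnertonDyer.Theorems.ManinLocalTwoThreeShortGermTransport
import Summits.BirchSwinnertonDyer.BirchSwinnertonDyer.Theorems.ManinLocalTwoThreeMinimalThreeTorsionIntegral
import Summits.BirchSwinnertonDyer.BirchSwinnertonDyer.Theorems.ManinLocalTwoThreeCubeRootIntegralAwayFromThree
import Summits.BirchSwinnertonDyer.BirchSwinnertonDyer.Theorems.ManinLocalTwoThreeKummerCubeRootThreeBounded
import Summits.BirchSwinnertonDyer.BirchSwinnertonDyer.Theorems.EisensteinDepletionAtTwoStarOptBNSFParamIntegral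
import Summits.BirchSwinnertonDyer.Rank1Residual.ManinAdditive.UDCKummerLine
import HarnessLib

/-!
# (AN1)-core of the UDC line: the cube root on the minimal model is INTEGRAL — `h^{min} = ρ⁻¹·h ∈ ℤ⟦q⟧` (with `D = 1`)
# (route `ManinLocalTwoThree`, crux C3 `ManinPrimeToThreeAtNine` stmt-BirchSwinnertonDyer-22968; cell bsd-f2-manin, prover seat p3 gen 15 —
# node (AN1) `KummerCubeRootBoundedDenominators` of the C3 LEAD's split of AN♮ (2026-08-29T14:46:35Z), MEMO-an §80.12 step (5))

Setting of -an's (AN) `KummerCubeRootCongruenceOfBounded`: `W` globally minimal, `D` a modular parametrisation datum (Manin constant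
`c = D.c`), `aₙ = aₙ(f)`, `T = (X₀, Y₀)` a rational point of order `3` of the short model `E_{W,c}`, `z` the short germ
(`log_{E_{W,c}}(z) = Σ aₙqⁿ/n`), `h` the normalised formal cube root of the tangent-line Kummer series (`h³ = Θ_T`, `h(0) = −1`)
which is `3`-adically bounded (conclusion of (BI)).  Put `z_W := exp_W(c·Σ aₙqⁿ/n)` (the germ of the MINIMAL model; `∈ ℤ⟦q⟧` by
Honda, tree `exists_int_coeff_formalExp_subst_lSeriesLog`) and `ρ := c·z/z_W ∈ 1 + qℚ⟦q⟧` (-an's `ρ = c·t_s/z_W`).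

* **`exists_int_minimalCubeRoot`** — there is `g ∈ ℚ⟦q⟧` with INTEGER coefficients, `g(0) = −1`, `c·z·g = z_W·h` (i.e. `g = ρ⁻¹h =
  h^{min}`) and `g³ = Θ^{min}(z_W) := Y_W(z_W) − y_T z_W³ − λ(X_W(z_W) z_W − x_T z_W³)`, the tangent-line Kummer series of `T` on `W`
  (`x_T = X₀/c² − b₂/12`, `y_T = Y₀/c³ − (a₁x_T + a₃)/2`, `λ = α/c − a₁/2` — integers, `…MinimalThreeTorsionIntegral`).

Proof.  `ρ⁻¹ = (X_W − (a₁/2)z_W X_W − (a₃/2)z_W³)·(X_W + (b₂/12)z_W²)⁻¹` (cleared `θ`, `…ShortGermTransport.shortGerm_mul_eq'`), so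
`g := ρ⁻¹h` has `c z g = z_W h`, `g(0) = −1`, and `g³ = ρ⁻³Θ_T = Θ^{min}(z_W)` by `Θ_T·z_W³ = (cz)³·Θ^{min}(z_W)`
(`kummerCubeSeries_mul_cube_eq'`).  `Θ^{min}(z_W) ∈ ℤ⟦q⟧` (integral model, `z_W ∈ ℤ⟦q⟧`, `x_T, y_T, λ ∈ ℤ`).  At `p ≠ 3`: a cube
root with unit constant term of a `p`-integral series is `p`-integral (`isPadicInt_of_pow_three_eq`, p3 g15).  At `p = 3`: `z`, hence
`c·3^K·z·Q'`, lies in `Frac ℤ⟦q⟧` (`exists_int_frac_formalVariableChange_subst`), so `A·g = B` with `A ≠ 0`, `B ∈ ℤ₃⟦q⟧`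
(`3^K h ∈ ℤ₍₃₎⟦q⟧`); `A³·g³ = B³` in the UFD `ℤ₃⟦q⟧` gives `A ∣ B`, i.e. `g ∈ ℤ₃⟦q⟧` — NO `3 ∣ c`, NO `9 ∣ N` needed here.

HONEST FRAMING.  This is the integrality INPUT of (AN♮); the modular form `F = D′ρ⁻¹h^{an}P(j)^eΔ^k` (AN2) and the UDC application
(AN3) are not touched; nothing about C3, Manin's conjecture or BSD is proved.  No definitions, no sorry.
[cite: SilvermanAEC2009, IV.1–IV.2 (formal group expansions have coefficients in `ℤ[a₁,…,a₆]`) and III.1 (changes of variables)]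
[cite: Honda1968, Thm. 5 (the formal group of the Néron model is strictly isomorphic over `ℤ` to the formal group of `Σ aₙn⁻ˢ`; used through the tree theorem `exists_int_coeff_formalExp_subst_lSeriesLog`)]
-/

set_option autoImplicit false
-- lint-debt: the directory name repeats the summit name (sibling precedent `ManinLocalTwoThreeKummerCubeRootThreeBounded.lean`)
set_option linter.dupNamespace false

noncomputable section

open scoped Classical
open PowerSeries WeierstrassCurve Literature.NumberTheory.EllipticCurves Literature.NumberTheory.EllipticCurves.ModularForms
open Summit.BirchSwinnertonDyer.Rank1Residual.ManinAdditive.CuspidalKummer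
open Summit.BirchSwinnertonDyer.Rank1Residual.ManinAdditive.CuspidalKummerThree
open Summit.BirchSwinnertonDyer.Rank1Residual.ManinAdditive.UDCKummerLine
open Summit.BirchSwinnertonDyer.BirchSwinnertonDyer.Theorems.ManinLocalTwoThree.ShortGermTransport
open Summit.BirchSwinnertonDyer.BirchSwinnertonDyer.Theorems.ManinLocalTwoThree.KummerCubeRootBounded

namespace Summit.BirchSwinnertonDyer.BirchSwinnertonDyer.Theorems.ManinLocalTwoThree.MinimalCubeRoot

/-! ## §1 Small facts: integer series, `L = Σ aₙ(W)qⁿ/n`, `z ≠ 0` -/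

/-- A rational series all of whose coefficients are integers is the image of the integer series of numerators. [folklore] -/
theorem map_mk_num_eq {f : ℚ⟦X⟧} (hf : ∀ n, ∃ k : ℤ, coeff n f = k) :
    PowerSeries.map (Int.castRingHom ℚ) (PowerSeries.mk fun n ↦ (coeff n f).num) = f := by
  ext n
  rw [coeff_map, coeff_mk, eq_intCast]
  obtain ⟨k, hk⟩ := hf n
  rw [hk, Rat.num_intCast]

/-- The newform's coefficients are the curve's: `aₙ = aₙ(W)`, so `Σ aₙqⁿ/n` is the series of the tree's Honda theorem. [folklore] -/
theorem lSeriesLog_eq_of_cuspCoeff (W : WeierstrassCurve ℚ) [W.IsElliptic] {N : ℕ} [NeZero N]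
    (D : ModularParametrizationData W N) (a : ℕ → ℤ) (ha : ∀ n, (a n : ℂ) = cuspCoeff D.f n) :
    lSeriesLog a = PowerSeries.mk fun j : ℕ ↦ ((W.LFunction j : ℤ) : ℚ) / j := by
  ext j
  rw [lSeriesLog, coeff_mk, coeff_mk]
  have h : (a j : ℂ) = (W.LFunction j : ℂ) := by rw [ha j, D.isNewformOf.2 j]
  have h' : a j = W.LFunction j := by exact_mod_cast h
  rw [h']

/-- The short germ has linear coefficient `1` (`a₁(f) = 1`); in particular `z ≠ 0`. [folklore] -/
theorem coeff_one_shortGerm (W : WeierstrassCurve ℚ) [W.IsElliptic] {N : ℕ} [NeZero N]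
    (D : ModularParametrizationData W N) (a : ℕ → ℤ) (ha : ∀ n, (a n : ℂ) = cuspCoeff D.f n) {z : ℚ⟦X⟧}
    (hz : IsParamGerm W D.c a z) : coeff 1 z = 1 := by
  have h := congrArg (coeff 1) hz.2
  rw [coeff_one_subst_eq_mul _ hz.1, coeff_one_formalLog, one_mul, lSeriesLog_eq_of_cuspCoeff W D a ha, coeff_mk,
    W.isMultiplicative_LFunction.map_one] at h
  simpa using h

/-! ## §2 The theorem -/

/-- **(AN1)-core: `h^{min} = ρ⁻¹h ∈ ℤ⟦q⟧`.**  Under the hypotheses of -an's (AN) (optimality is not even needed), with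
`z_W = exp_W(c·Σaₙqⁿ/n)`: there is `g ∈ ℚ⟦q⟧` with integer coefficients, `g(0) = −1`, `c·(z·g) = z_W·h`, and
`g³ = Y_W(z_W) − y_T z_W³ − λ·(X_W(z_W)·z_W − x_T z_W³)` (the tangent-line Kummer series of `T` on the minimal model).
See the module docstring for the proof. [cite: SilvermanAEC2009, IV.1–IV.2 and III.1] -/
theorem exists_int_minimalCubeRoot (W : WeierstrassCurve ℚ) [W.IsElliptic] [W.IsGloballyMinimal] {N : ℕ} [NeZero N]
    (D : ModularParametrizationData W N) (a : ℕ → ℤ) (ha : ∀ n, (a n : ℂ) = cuspCoeff D.f n)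
    (X₀ Y₀ : ℚ) (hT : IsShortThreeTorsion W D.c X₀ Y₀) (z : ℚ⟦X⟧) (hz : IsParamGerm W D.c a z)
    (h : ℚ⟦X⟧) (hh3 : h ^ 3 = kummerCubeSeries W D.c X₀ Y₀ z) (hh0 : constantCoeff h = -1)
    (hb : IsThreeAdicallyBounded h) :
    ∃ g : ℚ⟦X⟧, (∀ n, (coeff n g).den = 1) ∧ constantCoeff g = -1 ∧
      (D.c : ℚ) • (z * g) = W.formalExp.subst ((D.c : ℚ) • lSeriesLog a) * h ∧
      g ^ 3 = W.formalYMulCube.subst (W.formalExp.subst ((D.c : ℚ) • lSeriesLog a))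
          - C (Y₀ / (D.c : ℚ) ^ 3 - (W.a₁ * (X₀ / (D.c : ℚ) ^ 2 - W.b₂ / 12) + W.a₃) / 2)
              * W.formalExp.subst ((D.c : ℚ) • lSeriesLog a) ^ 3
          - C (tangentSlope W D.c X₀ Y₀ / D.c - W.a₁ / 2)
              * (W.formalXMulSq.subst (W.formalExp.subst ((D.c : ℚ) • lSeriesLog a)) * W.formalExp.subst ((D.c : ℚ) • lSeriesLog a)
                - C (X₀ / (D.c : ℚ) ^ 2 - W.b₂ / 12) * W.formalExp.subst ((D.c : ℚ) • lSeriesLog a) ^ 3) := by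
  -- §A notation and basic facts
  have hc : D.c ≠ 0 := D.maninConstant_ne_zero_holds
  have hc' : (D.c : ℚ) ≠ 0 := by exact_mod_cast hc
  set c : ℤ := D.c with hcdef
  set L := lSeriesLog a with hL
  set zW := W.formalExp.subst ((c : ℚ) • L) with hzW
  have hcL0 : constantCoeff ((c : ℚ) • L) = 0 := constantCoeff_smul_lSeriesLog c a
  have hzW0 : constantCoeff zW = 0 := constantCoeff_formalExp_subst W hcL0
  have hzWs : HasSubst zW := HasSubst.of_constantCoeff_zero' hzW0
  have hz0 : constantCoeff z = 0 := hz.1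
  have hz1 : coeff 1 z = 1 := coeff_one_shortGerm W D a ha hz
  have hzne : z ≠ 0 := fun h0 ↦ by rw [h0, map_zero] at hz1; exact zero_ne_one hz1
  set P := W.formalXMulSq.subst zW with hP
  have hP0 : constantCoeff P = 1 := by rw [hP, constantCoeff_subst_eq_constantCoeff hzW0, constantCoeff_formalXMulSq]
  set xq : ℚ := X₀ / (c : ℚ) ^ 2 - W.b₂ / 12 with hxq
  set yq : ℚ := Y₀ / (c : ℚ) ^ 3 - (W.a₁ * xq + W.a₃) / 2 with hyq
  set lq : ℚ := tangentSlope W c X₀ Y₀ / c - W.a₁ / 2 with hlq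
  -- `Θ^{min}(z_W)` and the transport identities
  set Θm : ℚ⟦X⟧ := W.formalYMulCube.subst zW - C yq * zW ^ 3 - C lq * (P * zW - C xq * zW ^ 3) with hΘm
  have hYW : W.formalYMulCube.subst zW = -P := formalYMulCube_subst_eq_neg W hzW0
  have hcube : kummerCubeSeries W c X₀ Y₀ z * zW ^ 3 = (C (c : ℚ) * z) ^ 3 * Θm :=
    kummerCubeSeries_mul_cube_eq' W hc a hz X₀ Y₀
  have hθ := shortGerm_mul_eq' W hc a hz
  rw [← hL, ← hzW, ← hP] at hθ
  -- §B `ρ⁻¹ = D'·U⁻¹` and `g = ρ⁻¹ h`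
  set U : ℚ⟦X⟧ := P + C (W.b₂ / 12) * zW ^ 2 with hU
  set D' : ℚ⟦X⟧ := P - C (W.a₁ / 2) * zW * P - C (W.a₃ / 2) * zW ^ 3 with hD'
  have hU0 : constantCoeff U = 1 := by simp [hU, hP0, hzW0]
  have hD'0 : constantCoeff D' = 1 := by simp [hD', hP0, hzW0]
  set Ui : ℚ⟦X⟧ := PowerSeries.invOfUnit U 1 with hUi
  have hUUi : U * Ui = 1 := by
    rw [hUi]; exact PowerSeries.mul_invOfUnit U 1 (by rw [hU0, Units.val_one])
  have hθ' : C (c : ℚ) * z * D' = zW * U := by rw [hD', hU]; linear_combination hθ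
  -- `z_W = c·z·ρ⁻¹`
  have hzWeq : zW = C (c : ℚ) * z * (D' * Ui) := by
    linear_combination (-Ui) * hθ' - zW * hUUi
  set g : ℚ⟦X⟧ := D' * Ui * h with hg
  have hczg : C (c : ℚ) * z * g = zW * h := by rw [hg, hzWeq]; ring
  have hUi0 : constantCoeff Ui = 1 := by
    have := congrArg constantCoeff hUUi
    rw [map_mul, hU0, one_mul, map_one] at this
    exact this
  have hg0 : constantCoeff g = -1 := by rw [hg, map_mul, map_mul, hD'0, hUi0, hh0]; norm_num
  -- `g³ = Θ^{min}(z_W)`: cancel `(c z)³ ≠ 0` in `Θ_T·z_W³ = (cz)³·Θm`, `z_W = c z ρ⁻¹`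
  have hcz0 : (C (c : ℚ) * z) ^ 3 ≠ 0 := by
    refine pow_ne_zero 3 (mul_ne_zero ?_ hzne)
    intro h0; apply hc'; simpa using congrArg constantCoeff h0
  have hg3 : g ^ 3 = Θm := by
    have e : (C (c : ℚ) * z) ^ 3 * g ^ 3 = (C (c : ℚ) * z) ^ 3 * Θm := by
      rw [← hcube, ← hh3, hg]
      have : zW ^ 3 = (C (c : ℚ) * z) ^ 3 * (D' * Ui) ^ 3 := by rw [hzWeq]; ring
      rw [this]; ring
    exact mul_left_cancel₀ hcz0 e
  refine ⟨g, ?_, hg0, ?_, by rw [hg3, hΘm]⟩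
  swap
  · rw [smul_eq_C_mul, ← hczg]; ring
  -- §C integrality of `Θm`: an integer model and integer series
  obtain ⟨V, hV⟩ := (inferInstance : W.IsIntegral ℤ).integral
  set φ : ℤ →+* ℚ := Int.castRingHom ℚ with hφ
  have hVW : V.map φ = W := by rw [hV, hφ, ← algebraMap_int_eq]; rfl
  -- `z_W ∈ ℤ⟦q⟧`
  have hzWint : ∀ n, ∃ k : ℤ, coeff n zW = k := fun n ↦ by
    rw [hzW, hL, lSeriesLog_eq_of_cuspCoeff W D a ha]
    exact DepletionAtTwo.ParamIntegral.exists_int_coeff_formalExp_subst_lSeriesLog W c n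
  set zWz : ℤ⟦X⟧ := PowerSeries.mk fun n ↦ (coeff n zW).num with hzWz
  have hzWmap : PowerSeries.map φ zWz = zW := map_mk_num_eq hzWint
  have hzWz0 : constantCoeff zWz = 0 := by
    rw [← coeff_zero_eq_constantCoeff_apply, hzWz, coeff_mk, coeff_zero_eq_constantCoeff_apply, hzW0, Rat.num_zero]
  have hzWzs : HasSubst zWz := HasSubst.of_constantCoeff_zero' hzWz0
  -- `X_W(z_W) ∈ ℤ⟦q⟧`
  set Pz : ℤ⟦X⟧ := V.formalXMulSq.subst zWz with hPz
  have hPmap : PowerSeries.map φ Pz = P := by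
    rw [hPz, Literature.RingTheory.FormalGroups.map_subst_apply hzWzs, map_formalXMulSq, hVW, hzWmap]
  -- the integers `x_T, y_T, λ`
  obtain ⟨hxden, hyden, hlden, -⟩ := MinimalThreeTorsion.minimalThreeTorsion_integral W D hT
  have hxZ : ((xq.num : ℤ) : ℚ) = xq := Rat.coe_int_num_of_den_eq_one hxden
  have hyZ : ((yq.num : ℤ) : ℚ) = yq := Rat.coe_int_num_of_den_eq_one hyden
  have hlZ : ((lq.num : ℤ) : ℚ) = lq := Rat.coe_int_num_of_den_eq_one hlden
  set Θz : ℤ⟦X⟧ := -Pz - C yq.num * zWz ^ 3 - C lq.num * (Pz * zWz - C xq.num * zWz ^ 3) with hΘz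
  have hCx : PowerSeries.map φ (C xq.num) = C xq := by rw [PowerSeries.map_C, hφ, eq_intCast, hxZ]
  have hCy : PowerSeries.map φ (C yq.num) = C yq := by rw [PowerSeries.map_C, hφ, eq_intCast, hyZ]
  have hCl : PowerSeries.map φ (C lq.num) = C lq := by rw [PowerSeries.map_C, hφ, eq_intCast, hlZ]
  have hΘmap : PowerSeries.map φ Θz = Θm := by
    rw [hΘz, hΘm, hYW]
    simp only [map_sub, map_neg, map_mul, map_pow, hCx, hCy, hCl, hPmap, hzWmap]
  have hΘint : ∀ n, (coeff n Θm).den = 1 := fun n ↦ by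
    rw [← hΘmap, coeff_map, hφ, eq_intCast]; exact Rat.den_intCast _
  -- §D `p ≠ 3`
  have hne3 : ∀ (p : ℕ) [Fact p.Prime], p ≠ 3 → ∀ n, ¬ p ∣ (coeff n g).den := by
    intro p _ hp3 n
    refine not_dvd_den_coeff_of_pow_three_eq hp3 (fun m ↦ ?_) hg3 hg0 n
    rw [hΘint m]; exact Nat.Prime.not_dvd_one Fact.out
  -- §E `p = 3`: `g ∈ Frac ℤ₃⟦q⟧` with an integral cube, hence integral
  have h3 : ∀ n, ¬ 3 ∣ (coeff n g).den := by
    -- `3^K h ∈ ℤ₃⟦q⟧`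
    obtain ⟨K, hK⟩ := hb
    set ι : ℚ⟦X⟧ →+* ℚ_[3]⟦X⟧ := PowerSeries.map (algebraMap ℚ ℚ_[3]) with hι
    set κ : ℤ_[3]⟦X⟧ →+* ℚ_[3]⟦X⟧ := PowerSeries.map (PadicInt.Coe.ringHom (p := 3)) with hκ
    set ψ : ℤ⟦X⟧ →+* ℤ_[3]⟦X⟧ := PowerSeries.map (Int.castRingHom ℤ_[3]) with hψ
    have hκinj : Function.Injective κ := PowerSeries.map_injective _ Subtype.val_injective
    have hψinj : Function.Injective ψ := PowerSeries.map_injective _ Int.cast_injective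
    have hκint : ∀ G : ℤ_[3]⟦X⟧, IsPadicInt (κ G) := fun G ↦ isPadicInt_iff_exists_powerSeries_map.mpr ⟨G, rfl⟩
    have hικ : ∀ G : ℤ⟦X⟧, ι (PowerSeries.map φ G) = κ (ψ G) := fun G ↦ by
      rw [hι, hκ, hψ, hφ]
      change ((PowerSeries.map (algebraMap ℚ ℚ_[3])).comp (PowerSeries.map (Int.castRingHom ℚ))) G =
        ((PowerSeries.map (PadicInt.Coe.ringHom (p := 3))).comp (PowerSeries.map (Int.castRingHom ℤ_[3]))) G
      rw [← PowerSeries.map_comp, ← PowerSeries.map_comp, RingHom.ext_int ((algebraMap ℚ ℚ_[3]).comp (Int.castRingHom ℚ))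
        ((PadicInt.Coe.ringHom (p := 3)).comp (Int.castRingHom ℤ_[3]))]
    have hKint : IsPadicInt (ι (C ((3 : ℚ) ^ K) * h)) := by
      rw [isPadicInt_iff_coeff]; intro n
      rw [hι, coeff_map, coeff_C_mul, eq_ratCast]
      exact Padic.norm_rat_le_one (hK n)
    obtain ⟨H₀, hH₀⟩ := isPadicInt_iff_exists_powerSeries_map.mp hKint
    -- `z ∈ Frac ℤ⟦q⟧` via the change of variables
    set vc : VariableChange ℚ := ⟨Units.mk0 ((c : ℚ)⁻¹) (inv_ne_zero hc'), -(W.b₂ / 12), -(W.a₁ / 2),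
      W.a₁ * W.b₂ / 24 - W.a₃ / 2⟩ with hvc
    have hzθ : z = (W.formalVariableChange vc).subst zW :=
      shortGerm_eq_formalVariableChange_subst W hc vc (by rw [hvc, Units.val_mk0]) rfl rfl rfl a hz
    have hwmap : W.formalW.subst zW * PowerSeries.map φ (1 : ℤ⟦X⟧) = PowerSeries.map φ (V.formalW.subst zWz) := by
      rw [map_one, mul_one, Literature.RingTheory.FormalGroups.map_subst_apply hzWzs, map_formalW, hVW, hzWmap]
    have hzmap : zW * PowerSeries.map φ (1 : ℤ⟦X⟧) = PowerSeries.map φ zWz := by rw [map_one, mul_one, hzWmap]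
    obtain ⟨P', Q', hQ'0, hPQ'⟩ :=
      W.exists_int_frac_formalVariableChange_subst vc hzW0 one_ne_zero hzmap one_ne_zero hwmap
    rw [← hzθ] at hPQ'
    -- `A·g = B`: `A = c·3^K·P'`, `B = z_W·Q'·(3^K h)`
    have hAB : C ((c : ℚ) * 3 ^ K) * PowerSeries.map φ P' * g = zW * PowerSeries.map φ Q' * (C ((3 : ℚ) ^ K) * h) := by
      rw [map_mul C (c : ℚ) ((3 : ℚ) ^ K)]
      linear_combination (C ((3 : ℚ) ^ K) * PowerSeries.map φ Q') * hczg - (C (c : ℚ) * C ((3 : ℚ) ^ K) * g) * hPQ'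
    set A₀ : ℤ_[3]⟦X⟧ := C (((c * 3 ^ K : ℤ) : ℤ_[3])) * ψ P' with hA₀
    set B₀ : ℤ_[3]⟦X⟧ := ψ zWz * ψ Q' * H₀ with hB₀
    have hr : algebraMap ℚ ℚ_[3] ((c : ℚ) * 3 ^ K) = PadicInt.Coe.ringHom (p := 3) ((c * 3 ^ K : ℤ) : ℤ_[3]) := by
      rw [PadicInt.Coe.ringHom_apply, PadicInt.coe_intCast, eq_ratCast]
      push_cast
      ring
    have hA : ι (C ((c : ℚ) * 3 ^ K) * PowerSeries.map φ P') = κ A₀ := by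
      rw [map_mul ι, hικ, hA₀, map_mul κ, hι, hκ, PowerSeries.map_C, PowerSeries.map_C, hr]
    have hH₀' : ι (C ((3 : ℚ) ^ K) * h) = κ H₀ := hH₀.symm
    have hB : ι (zW * PowerSeries.map φ Q' * (C ((3 : ℚ) ^ K) * h)) = κ B₀ := by
      rw [map_mul ι (zW * PowerSeries.map φ Q') (C ((3 : ℚ) ^ K) * h), hH₀', map_mul ι zW, ← hzWmap, hικ, hικ, hB₀,
        map_mul κ, map_mul κ]
    have hABp : κ A₀ * ι g = κ B₀ := by rw [← hA, ← hB, ← map_mul, hAB]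
    -- the cube: `A₀³·Θ₃ = B₀³` in `ℤ₃⟦q⟧`
    have hg3p : (ι g) ^ 3 = κ (ψ Θz) := by rw [← map_pow, hg3, ← hΘmap, hικ]
    have hR : A₀ ^ 3 * ψ Θz = B₀ ^ 3 := by
      apply hκinj
      rw [map_mul, map_pow, map_pow, ← hABp, mul_pow, hg3p]
    obtain ⟨g₀, hg₀⟩ : A₀ ∣ B₀ := dvd_of_pow_three_dvd_pow_three ⟨ψ Θz, hR.symm⟩
    -- `A₀ ≠ 0`
    have hP'ne : P' ≠ 0 := by
      intro h0
      have : PowerSeries.map φ Q' = 0 ∨ z = 0 := by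
        have e : z * PowerSeries.map φ Q' = 0 := by rw [hPQ', h0, map_zero]
        rcases mul_eq_zero.mp e with h1 | h1
        · exact Or.inr h1
        · exact Or.inl h1
      rcases this with h1 | h1
      · exact hQ'0 (PowerSeries.map_injective φ Int.cast_injective (by rw [h1, map_zero]))
      · exact hzne h1
    have hA₀ne : A₀ ≠ 0 := by
      rw [hA₀]
      refine mul_ne_zero ?_ (fun h0 ↦ hP'ne (hψinj (by rw [h0, map_zero])))
      intro h0
      have h1 := congrArg constantCoeff h0
      rw [constantCoeff_C, map_zero] at h1
      have h2 : (c : ℤ) * (3 : ℤ) ^ K ≠ 0 := mul_ne_zero hc (pow_ne_zero K (by norm_num))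
      have : ((c * 3 ^ K : ℤ) : ℤ_[3]) ≠ 0 := by exact_mod_cast h2
      exact this h1
    have hκA₀ne : κ A₀ ≠ 0 := fun h0 ↦ hA₀ne (hκinj (by rw [h0, map_zero]))
    -- `g = g₀ ∈ ℤ₃⟦q⟧`
    have hgint : IsPadicInt (ι g) := by
      have e : κ A₀ * ι g = κ A₀ * κ g₀ := by rw [hABp, hg₀, map_mul]
      rw [mul_left_cancel₀ hκA₀ne e]
      exact hκint g₀
    intro n
    refine not_dvd_den_of_norm_ratCast_le_one ?_
    have hn := (isPadicInt_iff_coeff.mp hgint) n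
    rw [hι, coeff_map, eq_ratCast] at hn
    exact hn
  -- §F all primes
  intro n
  by_contra hne
  obtain ⟨p, hp, hpd⟩ := Nat.exists_prime_and_dvd hne
  haveI : Fact p.Prime := ⟨hp⟩
  by_cases hp3 : p = 3
  · subst hp3; exact h3 n hpd
  · exact hne3 p hp3 n hpd

end Summit.BirchSwinnertonDyer.BirchSwinnertonDyer.Theorems.ManinLocalTwoThree.MinimalCubeRoot

end
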